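import Mathlib.Analysis.SpecialFunctions.Pow.Real
import Mathlib.Tactic.Linarith
import Mathlib.Tactic.Positivity
import Mathlib.Tactic.Ring
import Mathlib.Tactic.FieldSimp
import Summits.CriticalPhenomena.PercolationContinuityZ3.Theorems.PercNearOneGluingNoHeavyLowerTailAPLConjFUnion
import HarnessLib

/-!
# `NoHeavyLowerTail` (stmt-CriticalPhenomena-4575) — CONJECTURE F under apex piece-union: the mixed-leaning lemma on the whole `2u0 ≥ e` range

Support file (prover prim-ineq-gen-8 gen 35; `--supports stmt-CriticalPhenomena-4575`; memo
run/shared/lean/prim/prim-ineq-gen-8/FINDING-gen35-CONJF-UNION.md §0(1′)).  Pure real algebra: no definitions, no named facts, no sorries.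

`…APLConjFUnion.lean` proves the mixed-leaning union lemma (`conjF_c_union_mixed_norm`) under `x+y ≤ 1/2`, `x'+y' ≤ 1/2`
(`u0 ≥ e` for both pieces).  The complementary light case `e ≥ 2u0` is gen 34's LEMMA N, so the natural range is `x+y ≤ 2/3`
(`2u0 ≥ e`).  The extension is immediate from the master identity: if `x+y > 1/2` or `x'+y' > 1/2` then
`s = Q+Q'−(3/2)QQ' ≥ 1/2`, the base term `(3/2)((QQ'+hh')s − hh')` is nonnegative, and `κσa' − κDD'E ≥ 0` because
`σ ≥ hD` (`F_c(u)`), `a' ≥ D'` (`vbc ≥ e_v`) and `E ≤ h(1−Q'/2)`.  This file records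
* `conjF_c_union_mixed_norm_pp` — gadget coordinates, `x+y ≤ 2/3`, `x'+y' ≤ 2/3`;
* `conjF_c_union_mixed_pp` — the cell form (`uab+uac ≤ 2u0`, `vab+vac ≤ 2v0`), bridge identity `F_c(w) = D_uD_vS_uS_v·Φ`.
With LEMMA N this covers every mixed-leaning pair with `vbc ≥ e_v`; the leaves `vbc < e_v` and the aligned leaves remain
certificate-verified (gen 34 memo §3). [folklore algebra]
-/

namespace Summit.CriticalPhenomena.PercolationContinuityZ3.Theorems

namespace APL

/-- The master identity in plain gadget coordinates (`x, y` instead of `p², q²`). [folklore] -/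
theorem conjF_union_master_identity_xy (D x y r D' x' y' r' : ℝ) :
    (1 - (x*y' + y*x')) * (1 + 2*(1-r)*(1-r')
          - D*D'*((x-y)*(1-(x'+y')/2) - (y'-x')*(1-(x+y)/2)))
        - 3*(1-(x+y))*(1-(x'+y'))
    = 3/2*(((x+y)*(x'+y') + (x-y)*(y'-x'))*((x+y)+(x'+y')-3/2*(x+y)*(x'+y')) - (x-y)*(y'-x'))
      + (1 - (x*y' + y*x'))*(3*(x'+y')-2*r')*(2-3*(x+y))/2
      + (1 - (x*y' + y*x'))*(3*(x+y)-2*r)*(1-r')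
      - (1 - (x*y' + y*x'))*D*D'*((x-y)*(1-(x'+y')/2) - (y'-x')*(1-(x+y)/2)) := by
  ring

set_option maxHeartbeats 800000 in
/-- **Mixed-leaning union lemma on the full `2u0 ≥ e` range** (gadget coordinates): as `conjF_c_union_mixed_norm` but with
`x+y ≤ 2/3`, `x'+y' ≤ 2/3`.  If both sums are `≤ 1/2` this is the landed theorem; otherwise `s ≥ 1/2` and every term of the
master identity is nonnegative (`κσa' − κDD'E ≥ κDD'h'(1−Q/2) ≥ 0`). [folklore] -/
theorem conjF_c_union_mixed_norm_pp (D x y r D' x' y' r' : ℝ)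
    (hy : 0 ≤ y) (hyx : y ≤ x) (hQ : x + y ≤ 2/3) (hD : 0 ≤ D)
    (hl : x + y ≤ r) (hg : (r - x - y)^2 ≤ x*y) (hF : 2*r ≤ 3*(x+y) - D*(x-y))
    (hx' : 0 ≤ x') (hxy' : x' ≤ y') (hQ' : x' + y' ≤ 2/3) (hD' : 0 ≤ D')
    (hl' : x' + y' ≤ r') (hg' : (r' - x' - y')^2 ≤ x'*y') (hbc : D' ≤ 1 - r') :
    0 ≤ (1 - (x*y' + y*x')) * (1 + 2*(1-r)*(1-r')
          - D*D'*((x-y)*(1-(x'+y')/2) - (y'-x')*(1-(x+y)/2)))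
        - 3*(1-(x+y))*(1-(x'+y')) := by
  by_cases hc : x + y ≤ 1/2 ∧ x' + y' ≤ 1/2
  · exact conjF_c_union_mixed_norm D x y r D' x' y' r' hy hyx hc.1 hD hl hg hF hx' hxy' hc.2 hD' hl' hg' hbc
  · -- here s ≥ 1/2
    have hx : 0 ≤ x := le_trans hy hyx
    have hy' : 0 ≤ y' := le_trans hx' hxy'
    have hs : 1/2 ≤ (x+y)+(x'+y')-3/2*(x+y)*(x'+y') := by
      rcases not_and_or.mp hc with h1 | h1
      · have h1' : 1/2 < x + y := lt_of_not_ge h1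
        have : 0 ≤ (x'+y')*(1 - 3/2*(x+y)) := mul_nonneg (by linarith) (by linarith)
        nlinarith
      · have h1' : 1/2 < x' + y' := lt_of_not_ge h1
        have : 0 ≤ (x+y)*(1 - 3/2*(x'+y')) := mul_nonneg (by linarith) (by linarith)
        nlinarith
    -- σ' ≥ 0 from APL-G(v) and AM–GM
    have hσ'0 : 0 ≤ 3*(x'+y') - 2*r' := by
      have h1 : (r' - x' - y')^2 ≤ ((x'+y')/2)^2 := le_trans hg' (by nlinarith [sq_nonneg (x'-y')])
      have h2 := Real.sqrt_le_sqrt h1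
      rw [Real.sqrt_sq (show 0 ≤ r' - x' - y' by linarith), Real.sqrt_sq (by linarith : 0 ≤ (x'+y')/2)] at h2
      linarith
    have hκ0 : 0 ≤ 1 - (x*y' + y*x') := by
      have hC : x*y' + y*x' ≤ (x+y)*(x'+y') := by nlinarith [mul_nonneg hx hx', mul_nonneg hy hy']
      have : (x+y)*(x'+y') ≤ 2/3*(2/3) := mul_le_mul hQ hQ' (by linarith) (by norm_num)
      linarith
    have hh0 : 0 ≤ x - y := by linarith
    have hh0' : 0 ≤ y' - x' := by linarith
    have hhh : (x-y)*(y'-x') ≤ (x+y)*(x'+y') := mul_le_mul (by linarith) (by linarith) hh0' (by linarith)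
    have ha'0 : 0 ≤ 1 - r' := le_trans hD' hbc
    have hbase : 0 ≤ ((x+y)*(x'+y') + (x-y)*(y'-x'))*((x+y)+(x'+y')-3/2*(x+y)*(x'+y')) - (x-y)*(y'-x') := by
      have := mul_le_mul_of_nonneg_left hs (by nlinarith : 0 ≤ (x+y)*(x'+y') + (x-y)*(y'-x'))
      linarith
    have hX : 0 ≤ (1 - (x*y' + y*x'))*(3*(x'+y')-2*r')*(2-3*(x+y))/2 := by
      have := mul_nonneg (mul_nonneg hκ0 hσ'0) (by linarith : (0:ℝ) ≤ 2-3*(x+y)); linarith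
    -- κσa' − κDD'E ≥ 0 :  σ ≥ hD, a' ≥ D', E ≤ h(1−Q'/2) ≤ h
    have hW : (1 - (x*y' + y*x'))*D*D'*((x-y)*(1-(x'+y')/2) - (y'-x')*(1-(x+y)/2))
        ≤ (1 - (x*y' + y*x'))*(3*(x+y)-2*r)*(1-r') := by
      have hE : (x-y)*(1-(x'+y')/2) - (y'-x')*(1-(x+y)/2) ≤ (x-y) := by
        have := mul_nonneg hh0 (by linarith : (0:ℝ) ≤ (x'+y')/2)
        have := mul_nonneg hh0' (by linarith : (0:ℝ) ≤ 1-(x+y)/2)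
        linarith
      have s1 : (1 - (x*y' + y*x'))*D*D'*((x-y)*(1-(x'+y')/2) - (y'-x')*(1-(x+y)/2))
          ≤ (1 - (x*y' + y*x'))*D*D'*(x-y) :=
        mul_le_mul_of_nonneg_left hE (mul_nonneg (mul_nonneg hκ0 hD) hD')
      have s2 : ((1 - (x*y' + y*x'))*((x-y)*D))*D' ≤ ((1 - (x*y' + y*x'))*((x-y)*D))*(1-r') :=
        mul_le_mul_of_nonneg_left hbc (mul_nonneg hκ0 (mul_nonneg hh0 hD))
      have s3 : ((1 - (x*y' + y*x'))*(1-r'))*((x-y)*D) ≤ ((1 - (x*y' + y*x'))*(1-r'))*(3*(x+y)-2*r) :=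
        mul_le_mul_of_nonneg_left (by linarith) (mul_nonneg hκ0 ha'0)
      nlinarith
    rw [conjF_union_master_identity_xy]
    nlinarith

set_option maxHeartbeats 1600000 in
/-- **LEMMA U″ (mixed-leaning leaf) in cells, full `2u0 ≥ e` range.**  `u = (u0,uab,uac,ubc,u3) ≥ 0` b-leaning with
`uab+uac ≤ 2u0`, Harris, APL-G `(T_uD_u − e_uS_u)² ≤ uab·uac·S_u²`, `F_c(u) ≥ 0`; `v ≥ 0` c-leaning with `vab+vac ≤ 2v0`,
`vab+vac ≤ vbc`, Harris, APL-G.  Then `F_c(u ∪ v) ≥ 0`.  (With gen 34's LEMMA N for `e ≥ 2u0` this covers all mixed pairs with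
`vbc ≥ e_v`.) [folklore] -/
theorem conjF_c_union_mixed_pp (u0 uab uac ubc u3 v0 vab vac vbc v3 : ℝ)
    (hu0 : 0 ≤ u0) (huab : 0 ≤ uab) (huac : 0 ≤ uac) (hubc : 0 ≤ ubc) (hu3 : 0 ≤ u3)
    (hv0 : 0 ≤ v0) (hvab : 0 ≤ vab) (hvac : 0 ≤ vac) (hvbc : 0 ≤ vbc) (hv3 : 0 ≤ v3)
    (hub : uac ≤ uab) (hue : uab + uac ≤ 2*u0)
    (hHu : (uab+uac)*(u0+uab+uac+ubc+u3) ≤ (uab+uac+u3)*(u0+uab+uac))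
    (hGu : ((uab+uac+u3)*(u0+uab+uac) - (uab+uac)*(u0+uab+uac+ubc+u3))^2 ≤ uab*uac*(u0+uab+uac+ubc+u3)^2)
    (hFC : 0 ≤ 3*(uab+uac)*(u0+uab+uac+ubc+u3) - (u0+uab+uac)*(3*uab+uac+2*u3))
    (hvc : vab ≤ vac) (hve : vab + vac ≤ 2*v0) (hvbce : vab + vac ≤ vbc)
    (hHv : (vab+vac)*(v0+vab+vac+vbc+v3) ≤ (vab+vac+v3)*(v0+vab+vac))
    (hGv : ((vab+vac+v3)*(v0+vab+vac) - (vab+vac)*(v0+vab+vac+vbc+v3))^2 ≤ vab*vac*(v0+vab+vac+vbc+v3)^2) :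
    0 ≤ 3*((u0*vab+uab*v0+uab*vab)+(u0*vac+uac*v0+uac*vac))*(u0*v0+(u0*vab+uab*v0+uab*vab)+(u0*vac+uac*v0+uac*vac)+(u0*vbc+ubc*v0+ubc*vbc)+(u3*(v0+vab+vac+vbc+v3)+(u0+uab+uac+ubc+u3)*v3-u3*v3+uab*(vac+vbc)+uac*(vab+vbc)+ubc*(vab+vac))) - (u0*v0+(u0*vab+uab*v0+uab*vab)+(u0*vac+uac*v0+uac*vac))*(3*(u0*vab+uab*v0+uab*vab)+(u0*vac+uac*v0+uac*vac)+2*(u3*(v0+vab+vac+vbc+v3)+(u0+uab+uac+ubc+u3)*v3-u3*v3+uab*(vac+vbc)+uac*(vab+vbc)+ubc*(vab+vac))) := by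
  have poly : 3*((u0*vab+uab*v0+uab*vab)+(u0*vac+uac*v0+uac*vac))*(u0*v0+(u0*vab+uab*v0+uab*vab)+(u0*vac+uac*v0+uac*vac)+(u0*vbc+ubc*v0+ubc*vbc)+(u3*(v0+vab+vac+vbc+v3)+(u0+uab+uac+ubc+u3)*v3-u3*v3+uab*(vac+vbc)+uac*(vab+vbc)+ubc*(vab+vac))) - (u0*v0+(u0*vab+uab*v0+uab*vab)+(u0*vac+uac*v0+uac*vac))*(3*(u0*vab+uab*v0+uab*vab)+(u0*vac+uac*v0+uac*vac)+2*(u3*(v0+vab+vac+vbc+v3)+(u0+uab+uac+ubc+u3)*v3-u3*v3+uab*(vac+vbc)+uac*(vab+vbc)+ubc*(vab+vac)))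
      = ((u0+uab+uac)*(v0+vab+vac) - (uab*vac+uac*vab))
          * ((u0+uab+uac+ubc+u3)*(v0+vab+vac+vbc+v3) + 2*(u0+ubc)*(v0+vbc)
              - ((uab-uac)*((v0+vab+vac) - (vab+vac)/2) - (vac-vab)*((u0+uab+uac) - (uab+uac)/2)))
        - 3*u0*v0*(u0+uab+uac+ubc+u3)*(v0+vab+vac+vbc+v3) := by
    ring
  rw [poly]
  rcases eq_or_lt_of_le (show 0 ≤ u0+uab+uac by positivity) with hDu | hDu
  · have e0 : u0 = 0 := by linarith
    have e1 : uab = 0 := by linarith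
    have e2 : uac = 0 := by linarith
    subst e0 e1 e2
    norm_num
  rcases eq_or_lt_of_le (show 0 ≤ v0+vab+vac by positivity) with hDv | hDv
  · have e0 : v0 = 0 := by linarith
    have e1 : vab = 0 := by linarith
    have e2 : vac = 0 := by linarith
    subst e0 e1 e2
    norm_num
  have hSu : 0 < u0+uab+uac+ubc+u3 := by linarith
  have hSv : 0 < v0+vab+vac+vbc+v3 := by linarith
  have hDu0 : u0+uab+uac ≠ 0 := ne_of_gt hDu
  have hDv0 : v0+vab+vac ≠ 0 := ne_of_gt hDv
  have hSu0 : u0+uab+uac+ubc+u3 ≠ 0 := ne_of_gt hSu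
  have hSv0 : v0+vab+vac+vbc+v3 ≠ 0 := ne_of_gt hSv
  have h_y : 0 ≤ uac/(u0+uab+uac) := div_nonneg huac hDu.le
  have h_yx : uac/(u0+uab+uac) ≤ uab/(u0+uab+uac) := div_le_div_of_nonneg_right hub hDu.le
  have h_Q : uab/(u0+uab+uac) + uac/(u0+uab+uac) ≤ 2/3 := by
    rw [← add_div, div_le_iff₀ hDu]; linarith
  have h_D : 0 ≤ (u0+uab+uac)/(u0+uab+uac+ubc+u3) := div_nonneg hDu.le hSu.le
  have h_l : uab/(u0+uab+uac) + uac/(u0+uab+uac) ≤ (uab+uac+u3)/(u0+uab+uac+ubc+u3) := by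
    rw [← add_div, div_le_iff₀ hDu, div_mul_eq_mul_div, le_div_iff₀ hSu]; linarith
  have h_g : ((uab+uac+u3)/(u0+uab+uac+ubc+u3) - uab/(u0+uab+uac) - uac/(u0+uab+uac))^2
      ≤ uab/(u0+uab+uac) * (uac/(u0+uab+uac)) := by
    have e1 : (uab+uac+u3)/(u0+uab+uac+ubc+u3) - uab/(u0+uab+uac) - uac/(u0+uab+uac)
        = ((uab+uac+u3)*(u0+uab+uac) - (uab+uac)*(u0+uab+uac+ubc+u3)) / ((u0+uab+uac+ubc+u3)*(u0+uab+uac)) := by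
      field_simp; ring
    have e2 : uab/(u0+uab+uac) * (uac/(u0+uab+uac))
        = (uab*uac*(u0+uab+uac+ubc+u3)^2) / ((u0+uab+uac+ubc+u3)*(u0+uab+uac))^2 := by
      field_simp
    rw [e1, e2, div_pow]
    exact div_le_div_of_nonneg_right hGu (by positivity)
  have h_F : 2*((uab+uac+u3)/(u0+uab+uac+ubc+u3)) ≤ 3*(uab/(u0+uab+uac) + uac/(u0+uab+uac))
      - (u0+uab+uac)/(u0+uab+uac+ubc+u3) * (uab/(u0+uab+uac) - uac/(u0+uab+uac)) := by
    have e1 : 3*(uab/(u0+uab+uac) + uac/(u0+uab+uac))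
        - (u0+uab+uac)/(u0+uab+uac+ubc+u3) * (uab/(u0+uab+uac) - uac/(u0+uab+uac))
        - 2*((uab+uac+u3)/(u0+uab+uac+ubc+u3))
        = (3*(uab+uac)*(u0+uab+uac+ubc+u3) - (u0+uab+uac)*(3*uab+uac+2*u3)) / ((u0+uab+uac)*(u0+uab+uac+ubc+u3)) := by
      field_simp; ring
    have : 0 ≤ 3*(uab/(u0+uab+uac) + uac/(u0+uab+uac))
        - (u0+uab+uac)/(u0+uab+uac+ubc+u3) * (uab/(u0+uab+uac) - uac/(u0+uab+uac))
        - 2*((uab+uac+u3)/(u0+uab+uac+ubc+u3)) := by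
      rw [e1]; exact div_nonneg hFC (by positivity)
    linarith
  have h_x' : 0 ≤ vab/(v0+vab+vac) := div_nonneg hvab hDv.le
  have h_xy' : vab/(v0+vab+vac) ≤ vac/(v0+vab+vac) := div_le_div_of_nonneg_right hvc hDv.le
  have h_Q' : vab/(v0+vab+vac) + vac/(v0+vab+vac) ≤ 2/3 := by
    rw [← add_div, div_le_iff₀ hDv]; linarith
  have h_D' : 0 ≤ (v0+vab+vac)/(v0+vab+vac+vbc+v3) := div_nonneg hDv.le hSv.le
  have h_l' : vab/(v0+vab+vac) + vac/(v0+vab+vac) ≤ (vab+vac+v3)/(v0+vab+vac+vbc+v3) := by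
    rw [← add_div, div_le_iff₀ hDv, div_mul_eq_mul_div, le_div_iff₀ hSv]; linarith
  have h_g' : ((vab+vac+v3)/(v0+vab+vac+vbc+v3) - vab/(v0+vab+vac) - vac/(v0+vab+vac))^2
      ≤ vab/(v0+vab+vac) * (vac/(v0+vab+vac)) := by
    have e1 : (vab+vac+v3)/(v0+vab+vac+vbc+v3) - vab/(v0+vab+vac) - vac/(v0+vab+vac)
        = ((vab+vac+v3)*(v0+vab+vac) - (vab+vac)*(v0+vab+vac+vbc+v3)) / ((v0+vab+vac+vbc+v3)*(v0+vab+vac)) := by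
      field_simp; ring
    have e2 : vab/(v0+vab+vac) * (vac/(v0+vab+vac))
        = (vab*vac*(v0+vab+vac+vbc+v3)^2) / ((v0+vab+vac+vbc+v3)*(v0+vab+vac))^2 := by
      field_simp
    rw [e1, e2, div_pow]
    exact div_le_div_of_nonneg_right hGv (by positivity)
  have h_bc : (v0+vab+vac)/(v0+vab+vac+vbc+v3) ≤ 1 - (vab+vac+v3)/(v0+vab+vac+vbc+v3) := by
    have e1 : 1 - (vab+vac+v3)/(v0+vab+vac+vbc+v3) = (v0+vbc)/(v0+vab+vac+vbc+v3) := by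
      field_simp; ring
    rw [e1]; exact div_le_div_of_nonneg_right (by linarith) hSv.le
  have key := conjF_c_union_mixed_norm_pp
    ((u0+uab+uac)/(u0+uab+uac+ubc+u3)) (uab/(u0+uab+uac)) (uac/(u0+uab+uac)) ((uab+uac+u3)/(u0+uab+uac+ubc+u3))
    ((v0+vab+vac)/(v0+vab+vac+vbc+v3)) (vab/(v0+vab+vac)) (vac/(v0+vab+vac)) ((vab+vac+v3)/(v0+vab+vac+vbc+v3))
    h_y h_yx h_Q h_D h_l h_g h_F h_x' h_xy' h_Q' h_D' h_l' h_g' h_bc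
  have bridge : ((u0+uab+uac)*(v0+vab+vac) - (uab*vac+uac*vab))
          * ((u0+uab+uac+ubc+u3)*(v0+vab+vac+vbc+v3) + 2*(u0+ubc)*(v0+vbc)
              - ((uab-uac)*((v0+vab+vac) - (vab+vac)/2) - (vac-vab)*((u0+uab+uac) - (uab+uac)/2)))
        - 3*u0*v0*(u0+uab+uac+ubc+u3)*(v0+vab+vac+vbc+v3)
      = ((u0+uab+uac)*(v0+vab+vac)*(u0+uab+uac+ubc+u3)*(v0+vab+vac+vbc+v3))
        * ((1 - (uab/(u0+uab+uac)*(vac/(v0+vab+vac)) + uac/(u0+uab+uac)*(vab/(v0+vab+vac))))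
            * (1 + 2*(1-(uab+uac+u3)/(u0+uab+uac+ubc+u3))*(1-(vab+vac+v3)/(v0+vab+vac+vbc+v3))
              - (u0+uab+uac)/(u0+uab+uac+ubc+u3)*((v0+vab+vac)/(v0+vab+vac+vbc+v3))
                *((uab/(u0+uab+uac)-uac/(u0+uab+uac))*(1-(vab/(v0+vab+vac)+vac/(v0+vab+vac))/2)
                  - (vac/(v0+vab+vac)-vab/(v0+vab+vac))*(1-(uab/(u0+uab+uac)+uac/(u0+uab+uac))/2)))
          - 3*(1-(uab/(u0+uab+uac)+uac/(u0+uab+uac)))*(1-(vab/(v0+vab+vac)+vac/(v0+vab+vac)))) := by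
    field_simp
    ring
  rw [bridge]
  exact mul_nonneg (by positivity) key

end APL

end Summit.CriticalPhenomena.PercolationContinuityZ3.Theorems
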